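/-
Copyright (c) 2026 the pub-hodgecm-mathlib formalisation cell (harness21).  Prover seat hodgecm-mathlib-K2Liu-p27 (g2), Track B «K2-LIT»,
#184♮ = hLiu418 = `stmt-HodgeConjecture-24832`; LEAD F0P6-plan (g14) BATCH #111 (1) 22:53:32Z «F4 (G-gen) LEAD HAND := K2Liu-p27» (RULING M-158q (a): cyclicity
at each indefinite real place by road (R1), in-tree); F4 BRICK B1 (my census 22:57:20Z; K2Liu-p10 (g6) `CENSUS-FACE-G-Rgen` §3 (G-gen), `SIG-FaceG-Letters` L3).
THEOREMS ONLY (no `def`, no `instance`, no notation, no named-fact hypothesis, no `sorry`); lane `--supports stmt-HodgeConjecture-24832 --as helper`.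
-/
import Summits.HodgeConjecture.HodgeConjecture.Theorems.K2LiuU22KTypeArrowClosure   -- ★ S2-C part 2: the four live-arrow steps, `forall_kType_le_of_anchors`
import HarnessLib

/-!
# Crux `HLiu418`, organ F4 (G-gen), brick B1: ONE-ANCHOR CONE CLOSURES in the compact picture `ℂ[u, D⁻¹]` of `I_w(½, χ_w)` — the K-types a SINGLE
# Gaussian anchor generates under `𝔨_ℂ` and Weil's `𝔭^±` operators

Cell `hodgecm-mathlib`, crux item hLiu418 = `stmt-HodgeConjecture-24832` (helper lane `--supports`, count-neutral; closes no socket).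

★ S2-C `K2LiuU22KTypeArrowClosure.forall_kType_le_of_anchors` is the TWO-anchor fold: a subspace `Y ⊆ ℂ[u, D⁻¹]` stable under `𝔨_ℂ` (`L_{ab}`, `R_{ab}`) and
`P_{00}, P_{11}, M_{00}, M_{11}` at `s = ½` (`p = c₁ + 2`, `q = 1 − c₁`) containing BOTH Gaussian anchors `W_{(0,c₁+1)}` (of `V_{1,2}`) and `W_{(0,c₁)}` (of `V_{2,1}`)
contains every K-type.  FACE-G's hypothesis on the hol cut (RULING M-158n∕M-158q) hands the (R-gen) payer ONE anchor per real place — the Gaussian of the ACTUAL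
`V′_σ` — so F4 needs the ONE-anchor folds, i.e. the LOWER BOUNDS of cyclicity (★ S2-C part 1 `reflTransGen_of_snd_le` ∕ `reflTransGen_of_fst_ge` are exactly the
two regions; this file folds them with the live steps):
* §0 the pure reachability folds `forall_of_anchor_snd_le` ∕ `forall_of_anchor_fst_ge` (one-anchor twins of ★ `forall_of_anchors`);
* §1 **`forall_kType_le_of_anchor_snd_le`** — `W_{(0,c₁)} ≤ Y ⇒ W_{(k,l)} ≤ Y` for every `l ≤ c₁` (region 𝐃 = the K-type support of `R_w(V_{2,1})`; uses `M₀₀`,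
  `P₁₁`, `P₀₀`), and **`forall_kType_le_of_anchor_fst_ge`** — `W_{(0,c₁+1)} ≤ Y ⇒ W_{(k,l)} ≤ Y` for every `k + l ≥ c₁ + 1` (region 𝐀 = the support of
  `R_w(V_{1,2})`; uses `M₀₀`, `P₁₁`, `M₁₁`); the `⨆` forms `biSup_kType_le_of_anchor_snd_le` ∕ `_fst_ge`;
* §2 membership currency: `fkl_mem_of_anchor_snd_le` ∕ `fkl_mem_of_anchor_fst_ge` (`F_{k,l} = u₀₀^k D^l ∈ Y`, ★ `kType_le_iff_fkl_mem`) and the anchor in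
  `F`-letters (`h₂ : F_{0,c₁} ∈ Y`), the shape ★ S2-asm `fkl_zero_mem_of_anchor` delivers;
* §3 the SOCLE bookkeeping: `Soc := 𝐀 ∩ 𝐃`; the (2,1)-anchor `(0, c₁)` is NOT in 𝐀 and the (1,2)-anchor `(0, c₁+1)` is NOT in 𝐃 (`not_fst_ge_anchor₂₁`,
  `not_snd_le_anchor₁₂`; the covering 𝐀 ∪ 𝐃 is ★ `fst_ge_or_snd_le`) — the arrow-calculus face of «`f⁰_{±1} ∉ Soc` because `c*_{±1}(½) ≠ 0`»; and
  `forall_kType_le_of_anchor_snd_le_of_anchor_fst_ge`: both anchors give everything (★ two-anchor fold, restated in this file's argument order).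
Consumers: F4 B2 (`K2LiuArchSWImageKTypeCone`, the upper bound «SW values of signature-(2,1) data live in 𝐃») and B3 (`K2LiuArchSWDataInduction`, p10's L3); the
definite-signature towers (FACE-A's (L-c)) are the `s`-shifted twins and are NOT in this file.
References: [LeeZhu1998, §5 (5.3), Prop. 5.4 (i)]; [KudlaSweet1997, Thm. 1.2 (the p-adic twin, citation only)]; [GanQiuTakeda2014, Prop. 11].
HONEST LABEL: HC_CM is proved only modulo the 7 printed citations (2 remaining named inputs: hLiu418 = stmt-HodgeConjecture-24832,
h413 = stmt-HodgeConjecture-24833) until rung 0 closes; count-neutral helper, closes no socket.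
-/

set_option autoImplicit false
set_option linter.dupNamespace false -- the mandated namespace repeats `HodgeConjecture.HodgeConjecture`

noncomputable section

open Matrix Relation
open Summit.HodgeConjecture.HodgeConjecture.Cruxes.HLiu418.K2LiuU22CompactPictureDefs
open Summit.HodgeConjecture.HodgeConjecture.Cruxes.HLiu418.K2LiuU22KTypeMembership
open Summit.HodgeConjecture.HodgeConjecture.Cruxes.HLiu418.K2LiuU22KTypeStructure
open Summit.HodgeConjecture.HodgeConjecture.Cruxes.HLiu418.K2LiuU22KTypeTransitions
open Summit.HodgeConjecture.HodgeConjecture.Cruxes.HLiu418.K2LiuU22KTypePaths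
open Summit.HodgeConjecture.HodgeConjecture.Cruxes.HLiu418.K2LiuU22KTypeArrowClosure

namespace Summit.HodgeConjecture.HodgeConjecture.Cruxes.HLiu418.K2LiuU22KTypeConeClosure

/-! ## §0 The one-anchor folds (pure reachability, ★ S2-C part 1 currency) -/

section Folds

variable {R : ℕ × ℤ → ℕ × ℤ → Prop} {c₁ : ℤ}

/-- **ONE ANCHOR, REGION 𝐃**: a property closed under single arrows which holds at the `V_{2,1}`-anchor `(0, c₁)` holds on `{l ≤ c₁}` (★ `reflTransGen_of_snd_le` +
★ `reflTransGen_closed`). [cite: LeeZhu1998, Prop. 5.4 (i)] -/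
theorem forall_of_anchor_snd_le {P : ℕ × ℤ → Prop} (hP : ∀ a b, R a b → P a → P b)
    (hA1 : ∀ (j : ℕ) (m : ℤ), (j : ℤ) + m ≠ c₁ - 1 → R (j, m) (j + 1, m))
    (hA2 : ∀ (j : ℕ) (m : ℤ), m ≠ c₁ + 2 → R (j, m) (j + 1, m - 1))
    (hA4 : ∀ (j : ℕ) (m : ℤ), (j : ℤ) + 1 + m ≠ c₁ + 1 → R (j + 1, m) (j, m)) (h₂ : P (0, c₁)) (k : ℕ) (l : ℤ) (hl : l ≤ c₁) :
    P (k, l) :=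
  reflTransGen_closed hP (reflTransGen_of_snd_le hA1 hA2 hA4 k l hl) h₂

/-- **ONE ANCHOR, REGION 𝐀**: a property closed under single arrows which holds at the `V_{1,2}`-anchor `(0, c₁+1)` holds on `{c₁ + 1 ≤ k + l}` (★ `reflTransGen_of_fst_ge` +
★ `reflTransGen_closed`). [cite: LeeZhu1998, Prop. 5.4 (i)] -/
theorem forall_of_anchor_fst_ge {P : ℕ × ℤ → Prop} (hP : ∀ a b, R a b → P a → P b)
    (hA1 : ∀ (j : ℕ) (m : ℤ), (j : ℤ) + m ≠ c₁ - 1 → R (j, m) (j + 1, m))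
    (hA2 : ∀ (j : ℕ) (m : ℤ), m ≠ c₁ + 2 → R (j, m) (j + 1, m - 1)) (hA3 : ∀ (j : ℕ) (m : ℤ), m ≠ c₁ → R (j + 1, m) (j, m + 1))
    (h₁ : P (0, c₁ + 1)) (k : ℕ) (l : ℤ) (hkl : c₁ + 1 ≤ k + l) : P (k, l) :=
  reflTransGen_closed hP (reflTransGen_of_fst_ge hA1 hA2 hA3 k l hkl) h₁

end Folds

/-! ## §1 One-anchor closures -/

section OneAnchor

variable (Y : Submodule ℂ Carrier) (hL : ∀ a b : Fin 2, ∀ v ∈ Y, lOp pd uMat a b v ∈ Y) (hR : ∀ a b : Fin 2, ∀ v ∈ Y, rOp pd uMat a b v ∈ Y)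
include hL hR

/-- **REGION 𝐃 FROM THE `V_{2,1}`-ANCHOR**: `Y ⊆ ℂ[u, D⁻¹]` stable under `𝔨_ℂ` and under `P₀₀`, `P₁₁`, `M₀₀` at `s = ½` (`p = c₁ + 2`, `q = 1 − c₁`); if the Gaussian
anchor `W_{(0,c₁)}` of `V_{2,1}` lies in `Y`, then so does EVERY `W_{(k,l)}` with `l ≤ c₁` — the path `−e₂` down to row `l`, then `±e₁` along the row meets no dead
arrow (★ `reflTransGen_of_snd_le`). [cite: LeeZhu1998, §5 (5.3), Prop. 5.4 (i)] -/
theorem forall_kType_le_of_anchor_snd_le (c₁ : ℤ) {p q : ℂ} (hp : p = c₁ + 2) (hq : q = 1 - c₁)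
    (hP0 : ∀ v ∈ Y, pOp pd uMat dInv p 0 0 v ∈ Y) (hP1 : ∀ v ∈ Y, pOp pd uMat dInv p 1 1 v ∈ Y) (hM0 : ∀ v ∈ Y, mOp pd uMat q 0 0 v ∈ Y)
    (h₂ : kType 0 c₁ ≤ Y) (k : ℕ) (l : ℤ) (hl : l ≤ c₁) : kType k l ≤ Y := by
  subst hp hq
  refine forall_of_anchor_snd_le (R := fun a b : ℕ × ℤ => kType a.1 a.2 ≤ Y → kType b.1 b.2 ≤ Y) (P := fun a : ℕ × ℤ => kType a.1 a.2 ≤ Y) (c₁ := c₁)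
    (fun _ _ hab ha => hab ha) ?_ ?_ ?_ h₂ k l hl
  · -- (A1) `+e₁` via `M₀₀`
    intro j m hjm
    refine kType_succ_le_of_le Y hL hR hM0 ?_
    show (1 - (c₁ : ℂ)) + ((j : ℕ) : ℂ) + (m : ℂ) ≠ 0
    have h0 : ((1 - c₁ + (j : ℤ) + m : ℤ) : ℂ) ≠ 0 := Int.cast_ne_zero.2 (by omega)
    push_cast at h0 ⊢
    exact h0
  · -- (A2) `−e₂` via `P₁₁`
    intro j m hm
    refine kType_succ_pred_le_of_le Y hL hR hP1 ?_
    show (c₁ : ℂ) + 2 - (m : ℂ) ≠ 0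
    have h0 : ((c₁ + 2 - m : ℤ) : ℂ) ≠ 0 := Int.cast_ne_zero.2 (by omega)
    push_cast at h0 ⊢
    exact h0
  · -- (A4) `−e₁` via `P₀₀`
    intro j m hjm
    refine kType_le_of_succ_le Y hL hR hP0 ?_
    show (c₁ : ℂ) + 2 - ((j : ℕ) : ℂ) - (m : ℂ) - 2 ≠ 0
    have h0 : ((c₁ + 2 - (j : ℤ) - m - 2 : ℤ) : ℂ) ≠ 0 := Int.cast_ne_zero.2 (by omega)
    push_cast at h0 ⊢
    exact h0

/-- **REGION 𝐀 FROM THE `V_{1,2}`-ANCHOR**: `Y` stable under `𝔨_ℂ` and under `P₁₁`, `M₀₀`, `M₁₁` at `s = ½`; if the Gaussian anchor `W_{(0,c₁+1)}` of `V_{1,2}` lies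
in `Y`, then so does EVERY `W_{(k,l)}` with `c₁ + 1 ≤ k + l` (★ `reflTransGen_of_fst_ge`: `+e₁` along row `c₁+1`, then `∓e₂`). [cite: LeeZhu1998, §5 (5.3), Prop. 5.4 (i)] -/
theorem forall_kType_le_of_anchor_fst_ge (c₁ : ℤ) {p q : ℂ} (hp : p = c₁ + 2) (hq : q = 1 - c₁)
    (hP1 : ∀ v ∈ Y, pOp pd uMat dInv p 1 1 v ∈ Y) (hM0 : ∀ v ∈ Y, mOp pd uMat q 0 0 v ∈ Y) (hM1 : ∀ v ∈ Y, mOp pd uMat q 1 1 v ∈ Y)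
    (h₁ : kType 0 (c₁ + 1) ≤ Y) (k : ℕ) (l : ℤ) (hkl : c₁ + 1 ≤ k + l) : kType k l ≤ Y := by
  subst hp hq
  refine forall_of_anchor_fst_ge (R := fun a b : ℕ × ℤ => kType a.1 a.2 ≤ Y → kType b.1 b.2 ≤ Y) (P := fun a : ℕ × ℤ => kType a.1 a.2 ≤ Y) (c₁ := c₁)
    (fun _ _ hab ha => hab ha) ?_ ?_ ?_ h₁ k l hkl
  · -- (A1) `+e₁` via `M₀₀`
    intro j m hjm
    refine kType_succ_le_of_le Y hL hR hM0 ?_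
    show (1 - (c₁ : ℂ)) + ((j : ℕ) : ℂ) + (m : ℂ) ≠ 0
    have h0 : ((1 - c₁ + (j : ℤ) + m : ℤ) : ℂ) ≠ 0 := Int.cast_ne_zero.2 (by omega)
    push_cast at h0 ⊢
    exact h0
  · -- (A2) `−e₂` via `P₁₁`
    intro j m hm
    refine kType_succ_pred_le_of_le Y hL hR hP1 ?_
    show (c₁ : ℂ) + 2 - (m : ℂ) ≠ 0
    have h0 : ((c₁ + 2 - m : ℤ) : ℂ) ≠ 0 := Int.cast_ne_zero.2 (by omega)
    push_cast at h0 ⊢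
    exact h0
  · -- (A3) `+e₂` via `M₁₁`
    intro j m hm
    refine kType_le_succ_of_succ_le Y hL hR hM1 ?_
    show (1 - (c₁ : ℂ)) + (m : ℂ) - 1 ≠ 0
    have h0 : ((1 - c₁ + m - 1 : ℤ) : ℂ) ≠ 0 := Int.cast_ne_zero.2 (by omega)
    push_cast at h0 ⊢
    exact h0

/-- … `⨆_{l ≤ c₁} W_{(k,l)} ≤ Y` from the `V_{2,1}`-anchor. [cite: LeeZhu1998, Prop. 5.4 (i)] -/
theorem biSup_kType_le_of_anchor_snd_le (c₁ : ℤ) {p q : ℂ} (hp : p = c₁ + 2) (hq : q = 1 - c₁)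
    (hP0 : ∀ v ∈ Y, pOp pd uMat dInv p 0 0 v ∈ Y) (hP1 : ∀ v ∈ Y, pOp pd uMat dInv p 1 1 v ∈ Y) (hM0 : ∀ v ∈ Y, mOp pd uMat q 0 0 v ∈ Y)
    (h₂ : kType 0 c₁ ≤ Y) : ⨆ kl : {kl : ℕ × ℤ // kl.2 ≤ c₁}, kType kl.1.1 kl.1.2 ≤ Y :=
  iSup_le fun kl => forall_kType_le_of_anchor_snd_le Y hL hR c₁ hp hq hP0 hP1 hM0 h₂ kl.1.1 kl.1.2 kl.2

/-- … `⨆_{c₁+1 ≤ k+l} W_{(k,l)} ≤ Y` from the `V_{1,2}`-anchor. [cite: LeeZhu1998, Prop. 5.4 (i)] -/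
theorem biSup_kType_le_of_anchor_fst_ge (c₁ : ℤ) {p q : ℂ} (hp : p = c₁ + 2) (hq : q = 1 - c₁)
    (hP1 : ∀ v ∈ Y, pOp pd uMat dInv p 1 1 v ∈ Y) (hM0 : ∀ v ∈ Y, mOp pd uMat q 0 0 v ∈ Y) (hM1 : ∀ v ∈ Y, mOp pd uMat q 1 1 v ∈ Y)
    (h₁ : kType 0 (c₁ + 1) ≤ Y) : ⨆ kl : {kl : ℕ × ℤ // c₁ + 1 ≤ kl.1 + kl.2}, kType kl.1.1 kl.1.2 ≤ Y :=
  iSup_le fun kl => forall_kType_le_of_anchor_fst_ge Y hL hR c₁ hp hq hP1 hM0 hM1 h₁ kl.1.1 kl.1.2 kl.2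

/-! ## §2 The same in the `F_{k,l}`-membership currency -/

/-- **REGION 𝐃, `F`-LETTERS**: `F_{0,c₁} ∈ Y ⇒ F_{k,l} ∈ Y` for `l ≤ c₁` (★ `kType_le_iff_fkl_mem`). [cite: LeeZhu1998, p. 5032] -/
theorem fkl_mem_of_anchor_snd_le (c₁ : ℤ) {p q : ℂ} (hp : p = c₁ + 2) (hq : q = 1 - c₁)
    (hP0 : ∀ v ∈ Y, pOp pd uMat dInv p 0 0 v ∈ Y) (hP1 : ∀ v ∈ Y, pOp pd uMat dInv p 1 1 v ∈ Y) (hM0 : ∀ v ∈ Y, mOp pd uMat q 0 0 v ∈ Y)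
    (h₂ : fkl uMat dz 0 c₁ ∈ Y) (k : ℕ) (l : ℤ) (hl : l ≤ c₁) : fkl uMat dz k l ∈ Y :=
  fkl_mem_of_kType_le Y k l
    (forall_kType_le_of_anchor_snd_le Y hL hR c₁ hp hq hP0 hP1 hM0 ((kType_le_iff_fkl_mem Y hL hR 0 c₁).2 h₂) k l hl)

/-- **REGION 𝐀, `F`-LETTERS**: `F_{0,c₁+1} ∈ Y ⇒ F_{k,l} ∈ Y` for `c₁ + 1 ≤ k + l`. [cite: LeeZhu1998, p. 5032] -/
theorem fkl_mem_of_anchor_fst_ge (c₁ : ℤ) {p q : ℂ} (hp : p = c₁ + 2) (hq : q = 1 - c₁)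
    (hP1 : ∀ v ∈ Y, pOp pd uMat dInv p 1 1 v ∈ Y) (hM0 : ∀ v ∈ Y, mOp pd uMat q 0 0 v ∈ Y) (hM1 : ∀ v ∈ Y, mOp pd uMat q 1 1 v ∈ Y)
    (h₁ : fkl uMat dz 0 (c₁ + 1) ∈ Y) (k : ℕ) (l : ℤ) (hkl : c₁ + 1 ≤ k + l) : fkl uMat dz k l ∈ Y :=
  fkl_mem_of_kType_le Y k l
    (forall_kType_le_of_anchor_fst_ge Y hL hR c₁ hp hq hP1 hM0 hM1 ((kType_le_iff_fkl_mem Y hL hR 0 (c₁ + 1)).2 h₁) k l hkl)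

/-! ## §3 Socle bookkeeping and the escape fold -/

/-- **ONE ANCHOR + ONE ESCAPE = EVERYTHING (from the `V_{2,1}` side)**: if `Y` (stable under `𝔨_ℂ`, `P₀₀, P₁₁, M₀₀, M₁₁`) contains the `V_{2,1}`-anchor `W_{(0,c₁)}` AND
the `V_{1,2}`-anchor `W_{(0,c₁+1)}`, it contains every K-type (★ two-anchor fold); stated here so that B2's separation road reads: «`Y_{SW(2,1)} ∌ W_{(0,c₁+1)}`». -/
theorem forall_kType_le_of_anchor_snd_le_of_anchor_fst_ge (c₁ : ℤ) {p q : ℂ} (hp : p = c₁ + 2) (hq : q = 1 - c₁)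
    (hP0 : ∀ v ∈ Y, pOp pd uMat dInv p 0 0 v ∈ Y) (hP1 : ∀ v ∈ Y, pOp pd uMat dInv p 1 1 v ∈ Y)
    (hM0 : ∀ v ∈ Y, mOp pd uMat q 0 0 v ∈ Y) (hM1 : ∀ v ∈ Y, mOp pd uMat q 1 1 v ∈ Y)
    (h₂ : kType 0 c₁ ≤ Y) (h₁ : kType 0 (c₁ + 1) ≤ Y) (k : ℕ) (l : ℤ) : kType k l ≤ Y :=
  forall_kType_le_of_anchors Y hL hR c₁ hp hq hP0 hP1 hM0 hM1 h₁ h₂ k l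

end OneAnchor

/-- **THE `V_{2,1}`-ANCHOR IS OUTSIDE REGION 𝐀** (`(0, c₁)`: `0 + c₁ < c₁ + 1`) — so it is outside the socle `𝐀 ∩ 𝐃`. [cite: LeeZhu1998, §5 (5.3)] -/
theorem not_fst_ge_anchor₂₁ (c₁ : ℤ) : ¬ (c₁ + 1 ≤ ((0 : ℕ) : ℤ) + c₁) := by
  push_cast
  omega

/-- **THE `V_{1,2}`-ANCHOR IS OUTSIDE REGION 𝐃** (`(0, c₁+1)`: `c₁ + 1 > c₁`) — so it is outside the socle `𝐀 ∩ 𝐃`. [cite: LeeZhu1998, §5 (5.3)] -/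
theorem not_snd_le_anchor₁₂ (c₁ : ℤ) : ¬ (c₁ + 1 ≤ c₁) := by
  omega

/-- **THE SOCLE LABELS**: `(k, l) ∈ 𝐀 ∩ 𝐃 ⇔ l ≤ c₁ ∧ c₁ + 1 ≤ k + l`; in particular `1 ≤ k` there (no scalar K-type in the socle). [cite: LeeZhu1998, §5 (5.3)] -/
theorem one_le_of_mem_socle (c₁ : ℤ) (k : ℕ) (l : ℤ) (hA : c₁ + 1 ≤ k + l) (hD : l ≤ c₁) : 1 ≤ k := by
  omega

end Summit.HodgeConjecture.HodgeConjecture.Cruxes.HLiu418.K2LiuU22KTypeConeClosure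

end
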